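import Literature.Barriers.QuantumAdvantage.PPolyOraclesProofs
import Literature.Computability.Cryptography.OracleAdversaryDecider
import HarnessLib

/-!
# Barrier `PPolyOracles` (Aaronson–Chen 2017, Thm. 8.1): the language half through a decision form of Lemma 8.2

Second sibling proof file of `Literature/Barriers/QuantumAdvantage/PPolyOracles.lean`, continuing
`PPolyOraclesProofs.lean`. There Thm. 8.1,

> "Suppose `SampBPP = SampBQP` and `NP ⊆ BPP`. Then for every oracle `O ∈ P/poly`, we have
> `SampBPP^O = SampBQP^O` (and consequently `BPP^O = BQP^O`)." [AaronsonChen2017, Thm. 8.1, p. 32]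

is reduced (`aaronsonChen2017_thm81_of_lem82`) to Lemma 8.2 (`aaronsonChen2017_lem82`), the two
classical-in-quantum inclusions `SampPRel_subset_SampBQPRel`, `BPPRel_ofLanguage_subset_BQPRel`,
and a fourth leaf `BQPRel_subset_BPPRel_of_sampBQPRel_subset` carrying the printed
"consequently": `SampBQP^A ⊆ SampBPP^A ⟹ BQP^A ⊆ BPP^A`. In the tree's models that fourth leaf
hides a second quantum compilation (presenting the output bit of a `BQP^A` family, fed `|x⟩`, as a
`SampBQP^A` problem, fed `|⟨x, 1^k⟩⟩`, needs a uniform family locating `x` inside the pair) on top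
of a classical model bridge. This file replaces it:

* `aaronsonChen2017_lem82_decision` (named fact) — Lemma 8.2 read for DECISION procedures: under
  the same hypotheses, for every polynomial `q`, every poly-time uniform Clifford+T family `F` with
  oracle gates and every `k ≥ 1` there is a PPT oracle adversary whose acceptance probability is
  within `1/k` of `F`'s, for every `O ∈ SIZE(q)` and every input. In the paper this IS Lemma 8.2,
  applied to the `SampBQP` oracle algorithm "run `F`'s circuit on `x`, output the first measured
  bit" at accuracy `ε = 1/k` (a canonical-form algorithm may ignore its accuracy parameter), read
  through `|Pr[b = 1] − Pr[b' = 1]| ≤ ‖𝒟 − 𝒟'‖`; in the tree, where uniform families are indexed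
  by input length and fed `|x⟩`, it is recorded as its own fact with the same proof obligations as
  `aaronsonChen2017_lem82` (PAC learning of the gates under `NP ⊆ BPP`, simulation under
  `SampBPP = SampBQP`; the error analysis is the tree's proved
  `Literature.Computability.QuantumComplexity.tvDist_kernel_replKernel_le_of_forall_le` and
  `Literature.Computability.Learning.occam_finite_consistent_holds`).
* PROVED: `BQPRel_subset_BPPRel_of_lem82_decision` — "consequently `BQP^O ⊆ BPP^O`" for
  `O ∈ P/poly`, from the decision form and the tree's bridge
  `OracleAdversary.mem_BPPRel_of_abs_sub_le` (a PPT oracle adversary within `1/12` of a `BQP^O`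
  machine's acceptance probabilities decides its language with error `≤ 5/12 < 1/2`, hence in
  `BPP^O` after amplification, `Cryptography/OracleAdversaryDecider.lean`);
  `aaronsonChen2017_thm81_of_lem82_decision` — Thm. 8.1 from `aaronsonChen2017_lem82`,
  `aaronsonChen2017_lem82_decision`, `SampPRel_subset_SampBQPRel`, `BPPRel_ofLanguage_subset_BQPRel`;
  `PPolyOracles_of_leaves'` — the barrier fact from the resulting eight leaves.

## What remains for `aaronsonChen2017_thm81_holds`

`aaronsonChen2017_lem82` and `aaronsonChen2017_lem82_decision` (one machine-level proof serves
both: the PPT simulator of §8; its analysis is proved in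
`QuantumComplexity/OracleGateReplacement*.lean`, `Learning/OccamFiniteProofs.lean`), and the two
classical-in-quantum compilations `SampPRel_subset_SampBQPRel` (`AaronsonChenOracle.lean`),
`BPPRel_ofLanguage_subset_BQPRel` (`QuantumComplexity/CountingSimulationRel.lean`; unrelativized
form discharged as `BPP_subset_BQP_holds`).

## Sources

* [AaronsonChen2017] arXiv:1612.05903 (read via `lit read arxiv:1612.05903`): Thm. 8.1 and its
  proof from Lemma 8.2 (p. 32), Lemma 8.2 and its proof (pp. 32–33), §2.2 (canonical form of
  `SampBQP` oracle algorithms: "Given an input `⟨x, 0^{1/ε}⟩`, `M` first uses a classical routine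
  … to output a quantum circuit `C`", p. 12).
* [AroraBarakCC2009] Def. 7.1–7.3, §7.4.1 (error bounded away from `1/2`), as used by
  `OracleAdversaryDecider.lean`.
-/

noncomputable section

namespace Literature.Barriers.QuantumAdvantage

open _root_.Computability Literature.Computability.Complexity Literature.Computability.Complexity.Classes
  Literature.Computability.Complexity.Nondeterministic Literature.Computability.Cryptography
open Literature.Computability.QuantumComplexity (BPPRel_ofLanguage_subset_BQPRel)

/-! ### Lemma 8.2, decision form -/

/-- **Aaronson–Chen 2017, Lemma 8.2, for decision procedures** (fixed accuracy, one output bit):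
suppose `SampBPP = SampBQP` and `NP ⊆ BPP`; then for every polynomial `q`, every poly-time uniform
Clifford+T family `F` with oracle gates (a `BQP^O` machine in the tree's model, fed `|x⟩|0…0⟩`,
acceptance = wire `0`) and every `k ≥ 1`, there is a PPT oracle adversary `𝒜` (`OracleGames.lean` model,
Boolean output) such that for EVERY oracle language `O ∈ SIZE(q)` and every input `x`,
`|Pr[𝒜^O(x) = 1] − Pr[F^O accepts x]| ≤ 1/k`. The printed Lemma 8.2 ("for any polynomial `q(n)`
and any `SampBQP` oracle algorithm `M`, there is a `SampBPP` oracle algorithm `A` such that for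
every `O ∈ SIZE(q(n))` … `‖𝒟^M_{x,ε} − 𝒟^A_{x,ε}‖ ≤ ε`") applied to the canonical-form algorithm
that ignores `ε`, runs `F`'s circuit on `x` and outputs the first measured bit, at `ε = 1/k`;
stated separately from `aaronsonChen2017_lem82` because the tree's uniform families are indexed by
input length (the sampling form feeds `|⟨x, 1^k⟩⟩`). [cite: AaronsonChen2017, Lemma 8.2 (p. 32; one output bit, fixed ε = 1/k)] -/
def aaronsonChen2017_lem82_decision : Prop :=
  SampP = SampBQP → NP ⊆ BPP →
    ∀ (q : Polynomial ℕ) (F : QCircuitFamily cliffordT), F.IsUniform → ∀ k : ℕ, 0 < k →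
      ∃ 𝒜 : OracleAdversary Bool, 𝒜.IsPPT encodingBoolBool ∧
        ∀ O : Language Bool, O ∈ SIZE (fun n => q.eval n) → ∀ x : List Bool,
          |(𝒜.outputPMF (Oracle.ofLanguage O) x (some true)).toReal - F.acceptProbOn O x| ≤
            1 / (k : ℝ)

/-! ### "and consequently `BQP^O ⊆ BPP^O`" (proved from the decision form) -/

/-- **`BQP^O ⊆ BPP^O` for `O ∈ P/poly`, under `SampBPP = SampBQP` and `NP ⊆ BPP`**, from the
decision form of Lemma 8.2: for `L ∈ BQP^O` by the uniform family `F` (acceptance `≥ 2/3` on `L`,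
`≤ 1/3` off `L`) and `O ∈ SIZE(q)`, the PPT adversary of the decision form at `k = 12` accepts
within `1/12` of `F`, so it decides `L` with error `≤ 5/12 < 1/2` and `L ∈ BPP^O` by the tree's
bridge `OracleAdversary.mem_BPPRel_of_abs_sub_le` (witness machine in `P^O`, majority-of-three
amplification). [cite: AaronsonChen2017, Thm. 8.1 ("and consequently BPP^O = BQP^O", p. 32)] -/
theorem BQPRel_subset_BPPRel_of_lem82_decision (h : aaronsonChen2017_lem82_decision)
    (hS : SampP = SampBQP) (hNP : NP ⊆ BPP) {O : Language Bool} (hO : O ∈ PPoly) :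
    BQPRel O ⊆ BPPRel (Oracle.ofLanguage O) := by
  intro L hL
  obtain ⟨q, hq⟩ := exists_SIZE_of_mem_PPoly hO
  obtain ⟨F, hU, hacc⟩ := hL
  obtain ⟨𝒜, h𝒜, happrox⟩ := h hS hNP q F hU 12 (by norm_num)
  exact 𝒜.mem_BPPRel_of_abs_sub_le h𝒜 (π := F.acceptProbOn O) (η := 1 / 12) (by norm_num)
    (fun x => (happrox O hq x).trans (by norm_num)) (fun x hx => (hacc x).1 hx)
    (fun x hx => (hacc x).2 hx)

/-- Hence, with the tree fact `BPP^A ⊆ BQP^A`, the printed equality `BPP^O = BQP^O` for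
`O ∈ P/poly`. [cite: AaronsonChen2017, Thm. 8.1 (p. 32)] -/
theorem BPPRel_eq_BQPRel_of_lem82_decision (h : aaronsonChen2017_lem82_decision)
    (h₃ : BPPRel_ofLanguage_subset_BQPRel) (hS : SampP = SampBQP) (hNP : NP ⊆ BPP)
    {O : Language Bool} (hO : O ∈ PPoly) : BPPRel (Oracle.ofLanguage O) = BQPRel O :=
  Set.Subset.antisymm (h₃ O) (BQPRel_subset_BPPRel_of_lem82_decision h hS hNP hO)

/-! ### Theorem 8.1 and the barrier from the new leaf set -/

/-- **Thm. 8.1 from Lemma 8.2 (sampling and decision forms) and the two classical-in-quantum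
inclusions**: `SampBQP^O ⊆ SampBPP^O` is `aaronsonChen2017_thm81_sampBQP_subset_of_lem82`
(the printed `ε/2` argument, `PPolyOraclesProofs.lean`), `BQP^O ⊆ BPP^O` is
`BQPRel_subset_BPPRel_of_lem82_decision`, and the reverse inclusions are the leaves
`SampPRel_subset_SampBQPRel`, `BPPRel_ofLanguage_subset_BQPRel`.
[cite: AaronsonChen2017, Thm. 8.1 and Lemma 8.2 (p. 32)] -/
theorem aaronsonChen2017_thm81_of_lem82_decision (h82 : aaronsonChen2017_lem82)
    (h82d : aaronsonChen2017_lem82_decision) (h₂ : SampPRel_subset_SampBQPRel)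
    (h₃ : BPPRel_ofLanguage_subset_BQPRel) : aaronsonChen2017_thm81 := by
  intro hS hNP O hO
  exact ⟨Set.Subset.antisymm (h₂ O) (aaronsonChen2017_thm81_sampBQP_subset_of_lem82 h82 hS hNP O hO),
    BPPRel_eq_BQPRel_of_lem82_decision h82d h₃ hS hNP hO⟩

/-- **`PPolyOracles` from eight leaves**, the fourth leaf of `PPolyOracles_of_leaves`
(`BQPRel_subset_BPPRel_of_sampBQPRel_subset`) replaced by the decision form of Lemma 8.2: HILL,
GGM, Luby–Rackoff, the §7.2–7.3 fact, Lemma 8.2 in both forms, `SampBPP^A ⊆ SampBQP^A`,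
`BPP^A ⊆ BQP^A`. [cite: AaronsonChen2017, Thm. 7.6, Thm. 8.1, Lemma 7.4, Lemma 8.2] -/
theorem PPolyOracles_of_leaves' (hHILL : PRGExist_iff_OWFExist) (hGGM : PRFExist_of_PRGExist)
    (hLR : PRPExist_of_PRFExist) (h76 : aaronsonChen2017_thm76_of_prp)
    (h82 : aaronsonChen2017_lem82) (h82d : aaronsonChen2017_lem82_decision)
    (h₂ : SampPRel_subset_SampBQPRel) (h₃ : BPPRel_ofLanguage_subset_BQPRel) : PPolyOracles :=
  ⟨aaronsonChen2017_thm76_of_parts' hHILL hGGM hLR h76,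
    aaronsonChen2017_thm81_of_lem82_decision h82 h82d h₂ h₃⟩

end Literature.Barriers.QuantumAdvantage

end
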